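import Literature.GroupTheory.StableFibreWeightedCount   -- ★ (N5) p852404 `StableFibre.weighted_fibre_sum_eq` (F0P3-p02 (g23))
import HarnessLib

/-!
# The stable fibre has DENSITY ONE under the Cartan re-parametrisation: `Σ_T (idx T)⁻¹ (m T)⁻¹ (c T)⁻¹ Σ_i #fib(T,i) = 1` (pure group combinatorics; the pointwise count behind
# the `G`-side regrouping of the elliptic inner product, Rogawski 1990 §12.5 p. 182 ∕ p. 184)

Topic `GroupTheory`; namespace `Literature.GroupTheory.StableFibre`.  THEOREMS ONLY (no definition ∕ instance ∕ notation ∕ named fact ∕ `sorry`); imports ★ (N5) only.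
Cell `pub/hodgecm-mathlib`, crux H413 = `stmt-HodgeConjecture-24833` (lane `--supports`, count-neutral); seat F0P3a-p06 (g23) ((P3)∕(N5) lineage), ROAD «ELL-INNER»
(CHARTER-IN-PRINCIPLE LEAD T14-40; holder-designate LH6-p03 (g7)), the COUNT half of brick (E0) «G-REGROUP» — the complement of LH6-p03's (E0a) «TORUS EXCHANGE».

THE PRINT.  [Rogawski1990 §12.5 p. 182]: «the number of `δ ∈ 𝔇(T∕F)` such that `T^δ` is conjugate to `T₁` is `|Ω_F(T,G)|∕|Ω(T₁,G)|`»; p. 184 (proof of Prop. 12.5.2): the elliptic sum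
`Σ_{T} |Ω(T,G)|⁻¹ ∫_T` is regrouped over the `H`-side tori with the weights `|Ω_F(T,H)|⁻¹` and the `δ`-count.  In the tree's currency (★ (N5)'s letters: a finite system `SH` of
«Cartan» subgroups of `H`, complete and irredundant for regular classes, TORSOR count `idx T`, CLASS count `m T`, embeddings `ψ T i` (`i : Fin (n T)`) hitting every norm partner of a
regular `s ∈ T` exactly once up to conjugacy) the regrouping weight of a `G`-class `[g]` is `Σ_{T ∈ SH} (idx T)⁻¹ (m T)⁻¹ (c T)⁻¹ · Σ_i #{x ∈ T regular ∣ ψ T i x ∼ g}` where `c T` is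
the size of the stable norm fibre of `g` (a transversal `Q` of `{q regular ∣ R q g}` by `st`-classes; `c T = |Q|` is only read on members `T` that MEET the fibre).  THIS FILE: that
weight is EXACTLY `1` (`weighted_fibre_card_eq_one`) — ★ (N5) `weighted_fibre_sum_eq` at the constant stable function `F ≡ |Q|⁻¹`.  Consequence (the (E0) assembly, elsewhere):
`Σ_{T′ ∈ Sell} |W_G(T′)|⁻¹ ∫_{T′} Φ = Σ_{T ∈ SH} (idx T)⁻¹ (m T)⁻¹ (c T)⁻¹ Σ_i ∫_{T^{G-reg}} Φ(e_{T,i} s) ds` for class functions `Φ` supported on matched classes — the weights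
are FORCED by this count (over-counting by `[Ω_F(T,G):Ω_F(T,H)] = 3` on type (1) if `(c T)⁻¹` is dropped).
HONEST LABEL: count-neutral helper; closes no organ.  HC_CM is proved only modulo the 7 printed citations (2 remaining named inputs: hLiu418 = `stmt-HodgeConjecture-24832`,
h413 = `stmt-HodgeConjecture-24833`) until rung 0 closes.

## References
* [Rogawski1990] J. D. Rogawski, *Automorphic Representations of Unitary Groups in Three Variables*, Ann. of Math. Stud. 123 (1990), §3.5–3.7 pp. 28–31 (`Ω(T,G)`, `Ω_F(T,G)`,
  `𝔇(T∕F)`, Lemma 3.6.1, Prop. 3.7.1), §12.5 pp. 182–184 (the `δ`-count; the regrouping in the proof of Prop. 12.5.2).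
* [LanglandsShelstad1987] R. P. Langlands, D. Shelstad, *On the definition of transfer factors*, Math. Ann. 278 (1987), §1.3 (stable classes as unions of conjugacy classes).
-/

set_option autoImplicit false

open Finset

namespace Literature.GroupTheory.StableFibre

variable {G H : Type*} [Group G] [Group H]

/-- **THE STABLE FIBRE HAS DENSITY ONE.**  In the setting of ★ `weighted_fibre_sum_eq` (stable conjugacy `st` ⊇ conjugacy, `st`-invariant regularity `reg`, norm relation `R`
`st`-invariant on the left and conjugation-invariant on the right; a finite system `SH` complete and irredundant for regular classes with torsor count `idx`, class count `m`,
embeddings `ψ T i`, `i : Fin (n T)`, unique up to conjugacy on each norm partner), for every `g : G` whose stable fibre `{q ∣ reg q ∧ R q g}` has a NON-EMPTY transversal `Q`, with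
the finite fibres `fib T i = {x ∈ T ∣ reg x ∧ ψ T i x ∼ g}` and any count letter `c : Subgroup H → ℕ` that reads `|Q|` on the members meeting the fibre (`hc`):
`Σ_{T ∈ SH} (idx T)⁻¹ · (m T)⁻¹ · (c T)⁻¹ · Σ_{i : Fin (n T)} #fib(T,i) = 1` — ★ (N5) at the constant stable function `F ≡ |Q|⁻¹` (`Σ_{q ∈ Q} |Q|⁻¹ = 1`).
[cite: Rogawski1990, §12.5 p. 182 and p. 184] [cite: LanglandsShelstad1987, §1.3] -/
theorem weighted_fibre_card_eq_one
    (st : H → H → Prop) (hrefl : ∀ a, st a a) (hsymm : ∀ a b, st a b → st b a) (htrans : ∀ a b c, st a b → st b c → st a c)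
    (hconj : ∀ a b : H, IsConj a b → st a b)
    (reg : H → Prop) (hreg : ∀ a b, st a b → reg a → reg b)
    (R : H → G → Prop) (hRst : ∀ a b g, st a b → R a g → R b g) (hRconj : ∀ a (g g' : G), IsConj g g' → R a g → R a g')
    (SH : Finset (Subgroup H)) (idx m n : Subgroup H → ℕ) (ψ : (T : Subgroup H) → Fin (n T) → H → G)
    (hcomplete : ∀ h, reg h → ∃ T ∈ SH, ∃ s ∈ T, IsConj h s)
    (hirred : ∀ T ∈ SH, ∀ T' ∈ SH, ∀ s ∈ T, ∀ s' ∈ T', reg s → IsConj s s' → T = T')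
    (htorsor : ∀ T ∈ SH, ∀ s ∈ T, reg s → ∃ A : Finset H, (∀ x, x ∈ A ↔ x ∈ T ∧ IsConj s x) ∧ A.card = idx T)
    (hclasses : ∀ T ∈ SH, ∀ s ∈ T, reg s →
      ∃ C : Finset H, (∀ x ∈ C, st s x) ∧ (∀ x ∈ C, ∀ y ∈ C, IsConj x y → x = y) ∧ (∀ y, st s y → ∃ x ∈ C, IsConj y x) ∧ C.card = m T)
    (hψR : ∀ T ∈ SH, ∀ (i : Fin (n T)), ∀ s ∈ T, reg s → R s (ψ T i s))
    (hψuniq : ∀ T ∈ SH, ∀ s ∈ T, reg s → ∀ g, R s g → ∃! i : Fin (n T), IsConj (ψ T i s) g)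
    (g : G) (Q : Finset H) (hQ : ∀ q ∈ Q, reg q ∧ R q g) (hQinj : ∀ q ∈ Q, ∀ q' ∈ Q, st q q' → q = q')
    (hQexh : ∀ a, reg a → R a g → ∃ q ∈ Q, st a q) (hQne : Q.Nonempty)
    (fib : (T : Subgroup H) → Fin (n T) → Finset H) (hfib : ∀ T ∈ SH, ∀ (i : Fin (n T)), ∀ x, x ∈ fib T i ↔ x ∈ T ∧ reg x ∧ IsConj (ψ T i x) g)
    (c : Subgroup H → ℕ) (hc : ∀ T ∈ SH, ∀ i : Fin (n T), (fib T i).Nonempty → c T = Q.card) :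
    ∑ T ∈ SH, ((idx T : ℂ)⁻¹ * ((m T : ℂ))⁻¹ * ((c T : ℂ))⁻¹) * ∑ i : Fin (n T), ((fib T i).card : ℂ) = 1 := by
  classical
  have hQ0 : (Q.card : ℂ) ≠ 0 := Nat.cast_ne_zero.2 (Finset.card_pos.2 hQne).ne'
  -- ★ (N5) at the constant stable function `F ≡ |Q|⁻¹`
  have key := weighted_fibre_sum_eq st hrefl hsymm htrans hconj reg hreg R hRst hRconj SH idx m n ψ hcomplete hirred htorsor hclasses hψR hψuniq
    g Q hQ hQinj hQexh fib hfib (fun _ => ((Q.card : ℂ))⁻¹) (fun _ _ _ => rfl)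
  rw [Finset.sum_const, nsmul_eq_mul, mul_inv_cancel₀ hQ0] at key
  -- termwise: `(c T)⁻¹ · #fib(T,i) = #fib(T,i) · |Q|⁻¹` (empty fibre: both `0`; otherwise `c T = |Q|`)
  have hterm : ∀ T ∈ SH, ((idx T : ℂ)⁻¹ * ((m T : ℂ))⁻¹ * ((c T : ℂ))⁻¹) * ∑ i : Fin (n T), ((fib T i).card : ℂ) =
      ((idx T : ℂ)⁻¹ * ((m T : ℂ))⁻¹) * ∑ i : Fin (n T), ∑ _x ∈ fib T i, ((Q.card : ℂ))⁻¹ := by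
    intro T hT
    rw [mul_assoc, Finset.mul_sum, Finset.mul_sum, Finset.mul_sum]
    refine Finset.sum_congr rfl fun i _ => ?_
    rw [Finset.sum_const, nsmul_eq_mul]
    by_cases hne : (fib T i).Nonempty
    · rw [hc T hT i hne]
      ring
    · rw [Finset.not_nonempty_iff_eq_empty.1 hne, Finset.card_empty, Nat.cast_zero, mul_zero, zero_mul, mul_zero]
  rw [Finset.sum_congr rfl hterm]
  exact key.symm

end Literature.GroupTheory.StableFibre
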